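import Summits.BirchSwinnertonDyer.BirchSwinnertonDyer.Theorems.ErratumRoadFiveTwoVariableInvariantsSections
import Mathlib.RingTheory.QuotSMulTop
import HarnessLib

/-!
# The LOCAL CONTROL DEFECT `𝓜^G/T_c 𝓜^G` of the iterated big representation is FINITE — from (OPEN) `c(G) ⊇ pⁿℤ_p²`
# and (FIN-N) the finite cokernel of `ρ(g₁) − 1` on `A^{ker c}` (the kernel ASSEMBLY of the v4 stub
# `stub_localDefectFiniteAnomalous` of crux 25505; helper, `--supports stmt-BirchSwinnertonDyer-25505`)

Cell `bsd-stepL`, seat `bsd-stepL-imc-p1` (prover g23, 2026-08-28). Theorems only (no definition, no named fact,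
no `sorry`, no instance, no notation). Second half of the assembly (first half:
`…TwoVariableInvariantsSections`): for a COMPACT topological group `G`, `κ₁ κ₂ : G →ₜ* ℤ_p`, a `p`-primary
discrete `𝒪`-module `A` with continuous `𝒪`-linear `G`-action `ρ`, and the iterate
`𝓜 = bigRep κ₁ (bigRep κ₂ ρ)` (the two-variable `T ⊗ Λ_K^*`, outer variable `T_c`):

* §1 `exists_invariant_of_values` — **every value pattern on coset representatives is realised**: for a finite
  set `R ⊆ ℤ_p²` of representatives of `ℤ_p²/c(G)` (covering + independent, `Sections.exists_finset_cover_indep`)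
  and `b : R → A^{ker c}` there is `Ψ ∈ 𝓜^G` with `Ψ|_R = b` — the section `Ψ(r + c g) := ρ(g)(b r)`, smooth of
  the uniform level of `Sections.exists_level_of_forall_fixed` (COMPACTNESS) and `p`-primary of a uniform exponent.
  With `Sections.eq_of_forall_eq_of_cover`: evaluation `𝓜^G → (A^{ker c})^R` is a BIJECTION.
* §2 **`finite_quotSMulTop_X_invariants`** — `𝓜^G/T_c 𝓜^G` is FINITE as soon as (OPEN) `c(G) ⊇ pⁿℤ_p²` and
  (FIN-N) for one `g₁ ∈ ker κ₂` with `κ₁ g₁ = p^t` the cokernel of `ρ(g₁) − 1` on `A^{ker c}` is finite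
  (finitely many classes): `T_c`-cotorsion is a quotient of `((1+T_c)^{p^t} − 1)`-cotorsion
  (`InvariantsShift.finite_quotSMulTop_X_invariants_of_pow`), `(1+T_c)^{p^t} − 1` acts on `𝓜^G` as `ρ(g₁) − 1` on
  the values (`Sections.one_add_X_pow_sub_one_smul_apply_apply`), and along the evaluation bijection
  `𝓜^G ≅ (A^{ker c})^R` the quotient embeds in `(A^{ker c}/(ρ(g₁) − 1))^R`; `finite_quotSMulTop_X_invariants_of_open`
  derives `g₁` from (OPEN) and takes (FIN-N) for every `g ∈ ker κ₂ ∖ ker κ₁`.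

For `G = Γ_{K_𝔭̄}`, `κ₁ = κ_cyc`, `κ₂ = κ_ac`, `A = A_g` this is [JSW17, Lemma 3.4.1]'s local input
"`𝓜^{G_{K_v}}/(γ₊ − 1)𝓜^{G_{K_v}}` is finite" REDUCED to two statements about `A_g` and the local Galois group
only: (OPEN) the decomposition group at `𝔭̄` is open in `Gal(K_∞/K) ≅ ℤ_p²`, and (FIN-N) `γ₊`-type elements have
finite cokernel on `A_g^{G_{K_{∞,𝔭̄}}}` (TRUE on the whole `¬(dec)` corner, memo `CORNER-25505-imc-p1-g22.md` §2.4: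
`γ₊` moves the unramified unit-root line by a 1-unit `≠ 1`; on (dec) the invariants vanish outright).

HONEST FRAMING: algebra/topology on the tree's constructed carriers; nothing about any newform or curve is
asserted; conditional on nothing; BSD is proved for no pair; closes: none (T7).

## References
* [JetchevSkinnerWan2017] §3.4, Lemma 3.4.1 and its proof (arXiv:1512.06894 p. 14), Case 3(b) (p. 13).
* [SkinnerUrban2014] §3.1.1–3.1.3, Prop. 3.2.3 (the co-induced model).
* [Castella2018] §2.1–2.2.
-/

noncomputable section

open PowerSeries Literature.NumberTheory.GaloisRepresentations Literature.NumberTheory.EllipticCurves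
  Literature.NumberTheory.EllipticCurves.BigRepModule
open scoped Pointwise

-- D-0017: single-problem summit, the namespace repeats the problem name by design.
set_option linter.dupNamespace false
set_option autoImplicit false

namespace Summit.BirchSwinnertonDyer.BirchSwinnertonDyer.Theorems.ErratumThm23TwoVariable.LocalDefect

open Sections

variable {𝒪 : Type*} [CommRing 𝒪] [TopologicalSpace 𝒪] {p : ℕ} [Fact p.Prime]
  {A : Type*} [AddCommGroup A] [Module 𝒪 A] [TopologicalSpace A] [DiscreteTopology A]
  {G : Type*} [Group G] [TopologicalSpace G] [IsTopologicalGroup G] [CompactSpace G]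
  [TopologicalSpace (PowerSeries 𝒪)] [TopologicalSpace (PowerSeries (PowerSeries 𝒪))]
  (κ₁ κ₂ : G →ₜ* Multiplicative ℤ_[p]) (ρ : ContinuousRep G 𝒪 A)

/-! ## §1 Every value pattern on coset representatives is realised by an invariant -/

section Construction

/-- **Realising value patterns: the evaluation `𝓜^G → (A^{ker c})^R` is onto.** For `G` compact, `A` `p`-primary,
`c(G) ⊇ pⁿℤ_p²`, a finite covering and independent `R ⊆ ℤ_p²`, and values `b r ∈ A^{ker c}` (`r ∈ R`), the
section `Ψ(r + c g) := ρ(g)(b r)` is a well-defined (independence, `ker c`-invariance of the values) element of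
the iterate `C^∞(ℤ_p, C^∞(ℤ_p, A))` (smooth of the uniform level `max m n`, `m` from
`Sections.exists_level_of_forall_fixed`, and `p`-primary of a uniform exponent), `G`-invariant, with `Ψ|_R = b`.
[cite: JetchevSkinnerWan2017, §3.4, Lemma 3.4.1, proof (arXiv:1512.06894 p. 14)]
[cite: SkinnerUrban2014, §3.1.3 and Prop. 3.2.3 (the co-induced model)] -/
theorem exists_invariant_of_values (hA : ∀ a : A, ∃ k : ℕ, p ^ k • a = 0)
    (hOpen : ∃ n : ℕ, ∀ x y : ℤ_[p], ∃ g : G, (κ₁ g).toAdd = p ^ n * x ∧ (κ₂ g).toAdd = p ^ n * y)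
    {R : Finset (ℤ_[p] × ℤ_[p])}
    (hcov : ∀ z : ℤ_[p] × ℤ_[p], ∃ r ∈ R, ∃ g : G, z.1 = r.1 + (κ₁ g).toAdd ∧ z.2 = r.2 + (κ₂ g).toAdd)
    (hind : ∀ r ∈ R, ∀ r' ∈ R, ∀ g : G,
      r'.1 = r.1 + (κ₁ g).toAdd → r'.2 = r.2 + (κ₂ g).toAdd → r' = r)
    (b : ℤ_[p] × ℤ_[p] → A) (hb : ∀ r ∈ R, ∀ g : G, κ₁ g = 1 → κ₂ g = 1 → ρ g (b r) = b r) :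
    ∃ Ψ : BigRepModule (PowerSeries 𝒪) p (BigRepModule 𝒪 p A),
      (∀ g : G, bigRep κ₁ (bigRep κ₂ ρ) g Ψ = Ψ) ∧ ∀ r ∈ R, Ψ r.1 r.2 = b r := by
  classical
  -- a choice `z = r_z + c(g_z)`, `r_z ∈ R`
  choose rz hrz gz hz₁ hz₂ using hcov
  -- independence + invariance of the values: `r + c g = r' + c g'` forces `r = r'` and `ρ g (b r) = ρ g' (b r')`
  have key : ∀ r ∈ R, ∀ r' ∈ R, ∀ g g' : G,
      r.1 + (κ₁ g).toAdd = r'.1 + (κ₁ g').toAdd → r.2 + (κ₂ g).toAdd = r'.2 + (κ₂ g').toAdd →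
      r = r' ∧ ρ g (b r) = ρ g' (b r') := by
    intro r hr r' hr' g g' h₁ h₂
    have e₁ : r.1 = r'.1 + (κ₁ (g' * g⁻¹)).toAdd := by
      rw [map_mul κ₁, map_inv κ₁, toAdd_mul, toAdd_inv, ← add_assoc, ← sub_eq_add_neg]
      exact eq_sub_of_add_eq h₁
    have e₂ : r.2 = r'.2 + (κ₂ (g' * g⁻¹)).toAdd := by
      rw [map_mul κ₂, map_inv κ₂, toAdd_mul, toAdd_inv, ← add_assoc, ← sub_eq_add_neg]
      exact eq_sub_of_add_eq h₂
    have hrr : r = r' := hind r' hr' r hr (g' * g⁻¹) e₁ e₂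
    subst hrr
    refine ⟨rfl, ?_⟩
    have ha₁ : (κ₁ g).toAdd = (κ₁ g').toAdd := add_left_cancel h₁
    have ha₂ : (κ₂ g).toAdd = (κ₂ g').toAdd := add_left_cancel h₂
    have hk₁ : κ₁ (g⁻¹ * g') = 1 := by
      rw [← ofAdd_toAdd (κ₁ (g⁻¹ * g')), map_mul κ₁, map_inv κ₁, toAdd_mul, toAdd_inv, ha₁,
        neg_add_cancel, ofAdd_zero]
    have hk₂ : κ₂ (g⁻¹ * g') = 1 := by
      rw [← ofAdd_toAdd (κ₂ (g⁻¹ * g')), map_mul κ₂, map_inv κ₂, toAdd_mul, toAdd_inv, ha₂,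
        neg_add_cancel, ofAdd_zero]
    calc ρ g (b r) = ρ g (ρ (g⁻¹ * g') (b r)) := by rw [hb r hr _ hk₁ hk₂]
      _ = ρ (g * (g⁻¹ * g')) (b r) := by rw [← Module.End.mul_apply, ← map_mul]
      _ = ρ g' (b r) := by rw [mul_inv_cancel_left]
  -- the uniform stabiliser level `m` (compactness) and the radius `n` of (OPEN)
  obtain ⟨m, hm⟩ := exists_level_of_forall_fixed κ₁ κ₂ ρ (R.image b) (by
    intro a ha g h₁ h₂
    obtain ⟨r, hr, rfl⟩ := Finset.mem_image.mp ha
    exact hb r hr g h₁ h₂)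
  obtain ⟨n, hn⟩ := hOpen
  -- a uniform torsion exponent for the finitely many values
  have htor : ∃ k : ℕ, ∀ r ∈ R, p ^ k • b r = 0 := by
    choose k hk using hA
    refine ⟨R.sup (fun r ↦ k (b r)), fun r hr ↦ ?_⟩
    obtain ⟨d, hd⟩ := Nat.exists_eq_add_of_le (Finset.le_sup (f := fun r ↦ k (b r)) hr)
    rw [hd, pow_add, mul_comm, mul_smul, hk, smul_zero]
  obtain ⟨k, hk⟩ := htor
  -- the section `val z := ρ(g_z)(b r_z)`
  let val : ℤ_[p] × ℤ_[p] → A := fun z ↦ ρ (gz z) (b (rz z))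
  have hsec : ∀ (z : ℤ_[p] × ℤ_[p]) (g : G),
      val (z.1 + (κ₁ g).toAdd, z.2 + (κ₂ g).toAdd) = ρ g (val z) := by
    intro z g
    have e₁ := hz₁ (z.1 + (κ₁ g).toAdd, z.2 + (κ₂ g).toAdd)
    have e₂ := hz₂ (z.1 + (κ₁ g).toAdd, z.2 + (κ₂ g).toAdd)
    have h₁ : (rz (z.1 + (κ₁ g).toAdd, z.2 + (κ₂ g).toAdd)).1 +
        (κ₁ (gz (z.1 + (κ₁ g).toAdd, z.2 + (κ₂ g).toAdd))).toAdd = (rz z).1 + (κ₁ (g * gz z)).toAdd := by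
      rw [map_mul κ₁, toAdd_mul, add_comm ((κ₁ g).toAdd), ← add_assoc, ← hz₁ z]
      exact e₁.symm
    have h₂ : (rz (z.1 + (κ₁ g).toAdd, z.2 + (κ₂ g).toAdd)).2 +
        (κ₂ (gz (z.1 + (κ₁ g).toAdd, z.2 + (κ₂ g).toAdd))).toAdd = (rz z).2 + (κ₂ (g * gz z)).toAdd := by
      rw [map_mul κ₂, toAdd_mul, add_comm ((κ₂ g).toAdd), ← add_assoc, ← hz₂ z]
      exact e₂.symm
    obtain ⟨-, hval⟩ := key _ (hrz _) _ (hrz z) _ _ h₁ h₂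
    change ρ (gz _) (b (rz _)) = ρ g (ρ (gz z) (b (rz z)))
    rw [hval, map_mul ρ, Module.End.mul_apply]
  have hvalR : ∀ r ∈ R, val r = b r := by
    intro r hr
    have h₁ : (rz r).1 + (κ₁ (gz r)).toAdd = r.1 + (κ₁ (1 : G)).toAdd := by
      rw [map_one κ₁, toAdd_one, add_zero]; exact (hz₁ r).symm
    have h₂ : (rz r).2 + (κ₂ (gz r)).toAdd = r.2 + (κ₂ (1 : G)).toAdd := by
      rw [map_one κ₂, toAdd_one, add_zero]; exact (hz₂ r).symm
    obtain ⟨-, hval⟩ := key (rz r) (hrz r) r hr (gz r) 1 h₁ h₂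
    change ρ (gz r) (b (rz r)) = b r
    rw [hval, map_one ρ, Module.End.one_apply]
  -- smoothness: `val (z + w) = val z` for `w ∈ p^{max m n} ℤ_p²` (`w = c h` with `h` fixing the values)
  have hsmooth : ∀ (z w : ℤ_[p] × ℤ_[p]), w.1 ∈ Ideal.span {(p : ℤ_[p]) ^ max m n} →
      w.2 ∈ Ideal.span {(p : ℤ_[p]) ^ max m n} → val (z + w) = val z := by
    intro z w hw₁ hw₂
    have hw₁m : w.1 ∈ Ideal.span {(p : ℤ_[p]) ^ m} :=
      Ideal.span_singleton_le_span_singleton.mpr (pow_dvd_pow _ (le_max_left m n)) hw₁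
    have hw₂m : w.2 ∈ Ideal.span {(p : ℤ_[p]) ^ m} :=
      Ideal.span_singleton_le_span_singleton.mpr (pow_dvd_pow _ (le_max_left m n)) hw₂
    have hw₁n : w.1 ∈ Ideal.span {(p : ℤ_[p]) ^ n} :=
      Ideal.span_singleton_le_span_singleton.mpr (pow_dvd_pow _ (le_max_right m n)) hw₁
    have hw₂n : w.2 ∈ Ideal.span {(p : ℤ_[p]) ^ n} :=
      Ideal.span_singleton_le_span_singleton.mpr (pow_dvd_pow _ (le_max_right m n)) hw₂
    obtain ⟨x, hx⟩ := Ideal.mem_span_singleton'.mp hw₁n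
    obtain ⟨y, hy⟩ := Ideal.mem_span_singleton'.mp hw₂n
    obtain ⟨h, hh₁, hh₂⟩ := hn x y
    have hc₁ : (κ₁ h).toAdd = w.1 := by rw [hh₁, mul_comm, hx]
    have hc₂ : (κ₂ h).toAdd = w.2 := by rw [hh₂, mul_comm, hy]
    -- the conjugate `g_z⁻¹ h g_z` has the same `c`-value, hence fixes `b r_z`
    have hconj₁ : (κ₁ ((gz z)⁻¹ * h * gz z)).toAdd = w.1 := by
      rw [map_mul κ₁, map_mul κ₁, map_inv κ₁, toAdd_mul, toAdd_mul, toAdd_inv, hc₁]; ring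
    have hconj₂ : (κ₂ ((gz z)⁻¹ * h * gz z)).toAdd = w.2 := by
      rw [map_mul κ₂, map_mul κ₂, map_inv κ₂, toAdd_mul, toAdd_mul, toAdd_inv, hc₂]; ring
    have hfix : ρ ((gz z)⁻¹ * h * gz z) (b (rz z)) = b (rz z) :=
      hm _ (by rw [hconj₁]; exact hw₁m) (by rw [hconj₂]; exact hw₂m) _ (Finset.mem_image_of_mem b (hrz z))
    have hzw : z + w = (z.1 + (κ₁ h).toAdd, z.2 + (κ₂ h).toAdd) := by rw [hc₁, hc₂]; rfl
    calc val (z + w) = ρ h (val z) := by rw [hzw]; exact hsec z h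
      _ = ρ (h * gz z) (b (rz z)) := by
        change ρ h (ρ (gz z) (b (rz z))) = _
        rw [map_mul ρ, Module.End.mul_apply]
      _ = ρ (gz z * ((gz z)⁻¹ * h * gz z)) (b (rz z)) := by
        rw [← mul_assoc, ← mul_assoc, mul_inv_cancel, one_mul]
      _ = val z := by
        rw [map_mul ρ, Module.End.mul_apply, hfix]
  -- the inner functions `y ↦ val (x, y)` are smooth `p`-primary
  have hinner : ∀ x : ℤ_[p], (fun y : ℤ_[p] ↦ val (x, y)) ∈ bigRepSubmodule 𝒪 p A := by
    intro x
    refine ⟨⟨max m n, fun y y' hyy' ↦ ?_⟩, ⟨k, fun y ↦ ?_⟩⟩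
    · have e : ((x, y) : ℤ_[p] × ℤ_[p]) = (x, y') + (0, y - y') := Prod.ext (by simp) (by simp)
      change val (x, y) = val (x, y')
      rw [e]
      exact hsmooth (x, y') (0, y - y') (Ideal.zero_mem _) hyy'
    · change p ^ k • ρ (gz (x, y)) (b (rz (x, y))) = 0
      rw [← map_nsmul, hk _ (hrz _), map_zero]
  -- the outer function is smooth `p`-primary
  have houter : (fun x : ℤ_[p] ↦ BigRepModule.mk (fun y : ℤ_[p] ↦ val (x, y)) (hinner x)) ∈
      bigRepSubmodule (PowerSeries 𝒪) p (BigRepModule 𝒪 p A) := by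
    refine ⟨⟨max m n, fun x x' hxx' ↦ ?_⟩, ⟨k, fun x ↦ ?_⟩⟩
    · refine BigRepModule.ext fun y ↦ ?_
      rw [BigRepModule.mk_apply, BigRepModule.mk_apply]
      have e : ((x, y) : ℤ_[p] × ℤ_[p]) = (x', y) + (x - x', 0) := Prod.ext (by simp) (by simp)
      rw [e]
      exact hsmooth (x', y) (x - x', 0) hxx' (Ideal.zero_mem _)
    · refine BigRepModule.ext fun y ↦ ?_
      rw [BigRepModule.nsmul_apply, BigRepModule.zero_apply, BigRepModule.mk_apply]
      change p ^ k • ρ (gz (x, y)) (b (rz (x, y))) = 0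
      rw [← map_nsmul, hk _ (hrz _), map_zero]
  refine ⟨BigRepModule.mk _ houter, fun g ↦ ?_, fun r hr ↦ ?_⟩
  · refine BigRepModule.ext fun x ↦ BigRepModule.ext fun y ↦ ?_
    rw [bigRep_bigRep_apply_apply, BigRepModule.mk_apply, BigRepModule.mk_apply, BigRepModule.mk_apply,
      BigRepModule.mk_apply]
    have h := hsec (x - (κ₁ g).toAdd, y - (κ₂ g).toAdd) g
    rw [sub_add_cancel, sub_add_cancel] at h
    exact h.symm
  · rw [BigRepModule.mk_apply, BigRepModule.mk_apply]
    exact hvalR r hr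

end Construction

/-! ## §2 The local control defect is finite -/

section Main

variable [ContinuousSMul (PowerSeries (PowerSeries 𝒪)) (BigRepModule (PowerSeries 𝒪) p (BigRepModule 𝒪 p A))]

/-- **`𝓜^G/T_c 𝓜^G` is FINITE** for the iterate `𝓜 = bigRep κ₁ (bigRep κ₂ ρ)` over a compact `G` and a
`p`-primary discrete `A`, given (OPEN) `c(G) ⊇ pⁿℤ_p²` and (FIN-N): for one `g₁ ∈ ker κ₂` with `κ₁ g₁ = p^t`,
the classes of `A^{ker c}` modulo `(ρ(g₁) − 1)A^{ker c}` are represented by a finite set. Proof: `T_c`-cotorsion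
is a quotient of `((1+T_c)^{p^t} − 1)`-cotorsion; on `𝓜^G` that element acts as `u = ρ(g₁) − 1` on the values;
evaluation at finite coset representatives `R` (`Sections.exists_finset_cover_indep`) gives an additive map
`𝓜^G → (A^{ker c}/u)^R` to a finite group whose kernel lies in `((1+T_c)^{p^t} − 1)𝓜^G` (lift the values
through `u`, realise the lift by `exists_invariant_of_values`, compare by `Sections.eq_of_forall_eq_of_cover`).
This is the local input "`𝓜^{G_{K_v}}/(γ₊ − 1)𝓜^{G_{K_v}}` … finite" of [JSW17, Lemma 3.4.1] as a statement
about `A` and `c(G)` alone. [cite: JetchevSkinnerWan2017, §3.4, Lemma 3.4.1, proof (arXiv:1512.06894 p. 14)] -/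
theorem finite_quotSMulTop_X_invariants (hA : ∀ a : A, ∃ k : ℕ, p ^ k • a = 0)
    (hOpen : ∃ n : ℕ, ∀ x y : ℤ_[p], ∃ g : G, (κ₁ g).toAdd = p ^ n * x ∧ (κ₂ g).toAdd = p ^ n * y)
    {g₁ : G} {t : ℕ} (hg₁ : (κ₁ g₁).toAdd = ((p ^ t : ℕ) : ℤ_[p])) (hg₂ : κ₂ g₁ = 1)
    (hFin : ∃ S : Finset A, ∀ a : A, (∀ g : G, κ₁ g = 1 → κ₂ g = 1 → ρ g a = a) →
      ∃ s ∈ S, ∃ b : A, (∀ g : G, κ₁ g = 1 → κ₂ g = 1 → ρ g b = b) ∧ a = s + (ρ g₁ b - b)) :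
    Finite (QuotSMulTop (X : PowerSeries (PowerSeries 𝒪))
      ↥((bigRep (p := p) κ₁ (bigRep (p := p) κ₂ ρ)).toTopRep.ρ.invariants)) := by
  classical
  -- Step 0: `T_c`-cotorsion is a quotient of `((1+T_c)^{p^t} − 1)`-cotorsion
  suffices h : Finite (QuotSMulTop ((((1 : PowerSeries (PowerSeries 𝒪)) + X) ^ (p ^ t) - 1))
      ↥((bigRep (p := p) κ₁ (bigRep (p := p) κ₂ ρ)).toTopRep.ρ.invariants)) by
    haveI := h
    exact InvariantsShift.finite_quotSMulTop_X_invariants_of_pow κ₁ (bigRep κ₂ ρ) (p ^ t)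
  set MM := (bigRep (p := p) κ₁ (bigRep (p := p) κ₂ ρ)).toTopRep.ρ.invariants with hMM
  set f : PowerSeries (PowerSeries 𝒪) := ((1 : PowerSeries (PowerSeries 𝒪)) + X) ^ (p ^ t) - 1 with hf
  have hmem : ∀ (Φ : ↥MM) (g : G),
      bigRep κ₁ (bigRep κ₂ ρ) g (Φ : BigRepModule (PowerSeries 𝒪) p (BigRepModule 𝒪 p A)) = Φ :=
    fun Φ g ↦ Φ.2 g
  obtain ⟨R, hcov, hind⟩ := exists_finset_cover_indep κ₁ κ₂ hOpen
  obtain ⟨S, hS⟩ := hFin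
  -- the fixed vectors `N' = A^{ker c}` and the image `u N'` of `u = ρ(g₁) − 1`
  let N' : Submodule 𝒪 A :=
    { carrier := {a | ∀ g : G, κ₁ g = 1 → κ₂ g = 1 → ρ g a = a}
      zero_mem' := fun g _ _ ↦ map_zero _
      add_mem' := fun {a a'} ha ha' g h₁ h₂ ↦ by rw [map_add, ha g h₁ h₂, ha' g h₁ h₂]
      smul_mem' := fun c a ha g h₁ h₂ ↦ by
        change ρ g (c • a) = c • a
        rw [map_smul, ha g h₁ h₂] }
  have hN' : ∀ a : A, a ∈ N' ↔ ∀ g : G, κ₁ g = 1 → κ₂ g = 1 → ρ g a = a := fun a ↦ Iff.rfl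
  have hu : ∀ a ∈ N', ρ g₁ a - a ∈ N' := by
    intro a ha
    rw [hN'] at ha ⊢
    intro g h₁ h₂
    have hk₁ : κ₁ (g₁⁻¹ * g * g₁) = 1 := by
      rw [map_mul κ₁, map_mul κ₁, map_inv κ₁, h₁, mul_one, inv_mul_cancel]
    have hk₂ : κ₂ (g₁⁻¹ * g * g₁) = 1 := by
      rw [map_mul κ₂, map_mul κ₂, map_inv κ₂, h₂, mul_one, inv_mul_cancel]
    have e : g * g₁ = g₁ * (g₁⁻¹ * g * g₁) := by group
    rw [map_sub, ha g h₁ h₂, ← Module.End.mul_apply, ← map_mul ρ, e, map_mul ρ, Module.End.mul_apply,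
      ha _ hk₁ hk₂]
  let uN : Submodule 𝒪 ↥N' := (N'.map ((ρ g₁ : A →ₗ[𝒪] A) - 1)).comap N'.subtype
  have huN : ∀ a : ↥N', a ∈ uN ↔ ∃ b ∈ N', ρ g₁ b - b = (a : A) := by
    intro a
    rw [Submodule.mem_comap, Submodule.mem_map]
    exact Iff.rfl
  -- `N'/uN'` is finite (finitely many classes)
  have hQ : Finite (↥N' ⧸ uN) := by
    refine Finite.of_surjective
      (fun s : ↥S ↦ if h : (s : A) ∈ N' then (Submodule.Quotient.mk ⟨s, h⟩ : ↥N' ⧸ uN) else 0) ?_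
    intro q
    induction q using Submodule.Quotient.induction_on with
    | _ a =>
      obtain ⟨s, hs, b, hb, he⟩ := hS a a.2
      have hsN : s ∈ N' := by
        have e : s = a - (ρ g₁ b - b) := by rw [he, add_sub_cancel_right]
        rw [e]
        exact N'.sub_mem a.2 (hu b hb)
      refine ⟨⟨s, hs⟩, ?_⟩
      dsimp only
      rw [dif_pos hsN, Submodule.Quotient.eq, huN]
      refine ⟨-b, N'.neg_mem hb, ?_⟩
      change ρ g₁ (-b) - -b = s - a
      rw [map_neg, he]
      abel
  -- evaluation at the representatives, modulo `uN'`
  have hval : ∀ (Φ : ↥MM) (z : ℤ_[p] × ℤ_[p]),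
      (Φ : BigRepModule (PowerSeries 𝒪) p (BigRepModule 𝒪 p A)) z.1 z.2 ∈ N' :=
    fun Φ z g h₁ h₂ ↦ apply_apply_eq_of_forall_eq κ₁ κ₂ ρ (hmem Φ) z.1 z.2 h₁ h₂
  let E : ↥MM →+ (↥R → ↥N' ⧸ uN) := AddMonoidHom.mk'
    (fun Φ r ↦ Submodule.Quotient.mk
      ⟨(Φ : BigRepModule (PowerSeries 𝒪) p (BigRepModule 𝒪 p A)) r.1.1 r.1.2, hval Φ r.1⟩)
    (fun Φ Ψ ↦ by
      funext r
      rw [Pi.add_apply, ← Submodule.Quotient.mk_add]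
      rfl)
  -- the kernel of `E` lies in `f • 𝓜^G`
  have hker : E.ker ≤ (f • (⊤ : Submodule (PowerSeries (PowerSeries 𝒪)) ↥MM)).toAddSubgroup := by
    intro Φ hΦ
    rw [AddMonoidHom.mem_ker] at hΦ
    have hb : ∀ r : ↥R, ∃ b : A, b ∈ N' ∧
        (Φ : BigRepModule (PowerSeries 𝒪) p (BigRepModule 𝒪 p A)) r.1.1 r.1.2 = ρ g₁ b - b := by
      intro r
      have h := congrFun hΦ r
      rw [Pi.zero_apply] at h
      change (Submodule.Quotient.mk _ : ↥N' ⧸ uN) = 0 at h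
      rw [Submodule.Quotient.mk_eq_zero, huN] at h
      obtain ⟨b, hb, hbe⟩ := h
      exact ⟨b, hb, hbe.symm⟩
    choose b hbN hbe using hb
    let b' : ℤ_[p] × ℤ_[p] → A := fun z ↦ if h : z ∈ R then b ⟨z, h⟩ else 0
    have hb'R : ∀ (r : ℤ_[p] × ℤ_[p]) (hr : r ∈ R), b' r = b ⟨r, hr⟩ := fun r hr ↦ dif_pos hr
    obtain ⟨Ψ, hΨ, hΨR⟩ := exists_invariant_of_values κ₁ κ₂ ρ hA hOpen hcov hind b'
      (fun r hr g h₁ h₂ ↦ by rw [hb'R r hr]; exact (hN' _).mp (hbN ⟨r, hr⟩) g h₁ h₂)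
    have hfΨ : f • Ψ = (Φ : BigRepModule (PowerSeries 𝒪) p (BigRepModule 𝒪 p A)) := by
      refine eq_of_forall_eq_of_cover κ₁ κ₂ ρ (fun g ↦ ?_) (hmem Φ) (R := (↑R : Set (ℤ_[p] × ℤ_[p])))
        (fun z ↦ ?_) (fun r hr ↦ ?_)
      · rw [map_smul, hΨ g]
      · obtain ⟨r, hr, g, h⟩ := hcov z
        exact ⟨r, Finset.mem_coe.mpr hr, g, h⟩
      · have hr' : r ∈ R := Finset.mem_coe.mp hr
        rw [hf, one_add_X_pow_sub_one_smul_apply_apply κ₁ κ₂ ρ hΨ hg₁ hg₂, hΨR r hr', hb'R r hr',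
          ← hbe ⟨r, hr'⟩]
    rw [Submodule.mem_toAddSubgroup, Submodule.mem_smul_pointwise_iff_exists]
    exact ⟨⟨Ψ, fun g ↦ hΨ g⟩, Submodule.mem_top, Subtype.ext hfΨ⟩
  -- finite index
  haveI : Finite (↥R → ↥N' ⧸ uN) := Pi.finite
  haveI : Finite (↥MM ⧸ E.ker) := Finite.of_equiv _ (QuotientAddGroup.quotientKerEquivRange E).symm.toEquiv
  haveI : E.ker.FiniteIndex := AddSubgroup.finiteIndex_of_finite_quotient
  haveI := AddSubgroup.finiteIndex_of_le hker
  exact AddSubgroup.finite_quotient_of_finiteIndex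

omit [IsTopologicalGroup G] [CompactSpace G] in
/-- Bookkeeping: (OPEN) supplies an element `g₁ ∈ ker κ₂` with `κ₁ g₁ = pⁿ ≠ 0` (take `(x, y) = (1, 0)`).
[cite: JetchevSkinnerWan2017, §3.4 (arXiv:1512.06894 p. 14: γ₊ ∈ Γ_K topologically generating Gal(K_∞/K_∞^-))] -/
theorem exists_mem_ker_of_open
    (hOpen : ∃ n : ℕ, ∀ x y : ℤ_[p], ∃ g : G, (κ₁ g).toAdd = p ^ n * x ∧ (κ₂ g).toAdd = p ^ n * y) :
    ∃ (g₁ : G) (t : ℕ), (κ₁ g₁).toAdd = ((p ^ t : ℕ) : ℤ_[p]) ∧ κ₂ g₁ = 1 ∧ κ₁ g₁ ≠ 1 := by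
  obtain ⟨n, hn⟩ := hOpen
  obtain ⟨g₁, h₁, h₂⟩ := hn 1 0
  have hg₁ : (κ₁ g₁).toAdd = ((p ^ n : ℕ) : ℤ_[p]) := by rw [h₁, mul_one, Nat.cast_pow]
  refine ⟨g₁, n, hg₁, ?_, fun h ↦ ?_⟩
  · rw [← ofAdd_toAdd (κ₂ g₁), h₂, mul_zero, ofAdd_zero]
  · rw [h, toAdd_one] at hg₁
    exact absurd hg₁.symm (Nat.cast_ne_zero.mpr (pow_ne_zero _ (Fact.out : p.Prime).ne_zero))

/-- **The local control defect is finite — (OPEN) + (FIN-N) form.** As `finite_quotSMulTop_X_invariants`, with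
`g₁` supplied by (OPEN) and (FIN-N) required for every `g ∈ ker κ₂ ∖ ker κ₁` (the shape of the Galois input:
"every element of `Γ_{K_𝔭̄}` trivial on `K_∞^{ac}` and non-trivial on `K_∞^{cyc}` has finite cokernel on
`A_g^{G_{K_{∞,𝔭̄}}}`"). [cite: JetchevSkinnerWan2017, §3.4, Lemma 3.4.1, proof (arXiv:1512.06894 p. 14)] -/
theorem finite_quotSMulTop_X_invariants_of_open (hA : ∀ a : A, ∃ k : ℕ, p ^ k • a = 0)
    (hOpen : ∃ n : ℕ, ∀ x y : ℤ_[p], ∃ g : G, (κ₁ g).toAdd = p ^ n * x ∧ (κ₂ g).toAdd = p ^ n * y)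
    (hFin : ∀ g₁ : G, κ₂ g₁ = 1 → κ₁ g₁ ≠ 1 →
      ∃ S : Finset A, ∀ a : A, (∀ g : G, κ₁ g = 1 → κ₂ g = 1 → ρ g a = a) →
        ∃ s ∈ S, ∃ b : A, (∀ g : G, κ₁ g = 1 → κ₂ g = 1 → ρ g b = b) ∧ a = s + (ρ g₁ b - b)) :
    Finite (QuotSMulTop (X : PowerSeries (PowerSeries 𝒪))
      ↥((bigRep (p := p) κ₁ (bigRep (p := p) κ₂ ρ)).toTopRep.ρ.invariants)) := by
  obtain ⟨g₁, t, hg₁, hg₂, hne⟩ := exists_mem_ker_of_open κ₁ κ₂ hOpen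
  exact finite_quotSMulTop_X_invariants κ₁ κ₂ ρ hA hOpen hg₁ hg₂ (hFin g₁ hg₂ hne)

end Main

end Summit.BirchSwinnertonDyer.BirchSwinnertonDyer.Theorems.ErratumThm23TwoVariable.LocalDefect

end
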